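import Summits.QuantumFields.YangMills.Theorems.QuantileBitPuritySectors
import Summits.QuantumFields.YangMills.Theorems.FemtoTransferGapAxisPermutation
import HarnessLib

/-!
# Seam sectors: cubic symmetry — the total weight of a sector depends only on the orbit of its twist vector under axis permutations

Support module (`--supports` stmt-QuantumFields-23948, `QuantileBitPurity.HolonomyQuantileSubQuartic`; seat ym-dw-p1 g15, plan HOME `bc/g15-dw/PLAN-CORE-GAXIS.md`, module P1).
An axis permutation `π ∈ S₃` of the spatial torus acts on slices by `configPerm π` (tree), conjugating the centre twist `twist3 z` into `twist3 (z ∘ π⁻¹)`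
(`configPerm_twist3`) and a gauge transformation `g` into `g ∘ sitePerm π⁻¹` (`configPerm_gaugeTransform`); it preserves the transfer kernel
(`transferKernel_su2Rep_configPerm`) and the Haar measures.  Hence

★ `sectorWeight_one_perm`: `W_{z ∘ π⁻¹}(1) = W_z(1)`;

in particular the three singly-twisted sectors have equal weights and so do the three doubly-twisted ones (`sectorWeight_one_eq_of_single`,
`sectorWeight_one_eq_of_double`).  Use (plan §1): for the core event of the `x`-holonomy, the transverse-twisted sectors `(0,1,0),(0,0,1),(0,1,1)` carry at
most `2u + v ≤ (2/3)(3u + 3v)` of the non-periodic mass — `q < 1` needs no flux suppression.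

HONEST FRAMING: fixed-lattice symmetry bookkeeping; nothing about infinite volume, the continuum limit or the Clay gap.  No `sorry`, no new axiom, no new
definition.  References: [cite: Luscher1983, §2]; [cite: tHooft1979].
-/

set_option autoImplicit false

noncomputable section

open MeasureTheory Set Function
open scoped BigOperators
open Literature.MathematicalPhysics.QuantumLattice
open Literature.MathematicalPhysics.QuantumFieldTheory hiding SU2
open Summit.QuantumFields.YangMills.Theorems

namespace Summit.QuantumFields.YangMills.Theorems.FemtoTransferGap.TT

open Summit.QuantumFields.YangMills.Theorems.FemtoTransferGap

variable {L : ℕ} [NeZero L]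

/-! ## §1 Axis permutations conjugate the composite twist and permute the seam field -/

omit [NeZero L] in
/-- `P_π (twist3 z U) = twist3 (z ∘ π⁻¹) (P_π U)`. [cite: tHooft1979] -/
theorem configPerm_twist3 (π : Equiv.Perm (Fin 3)) (z : Fin 3 → Bool) (U : GaugeConfig 3 L SU2) :
    configPerm π (twist3 z U) = twist3 (z ∘ π.symm) (configPerm π U) := by
  funext e
  rw [configPerm_apply, twist3_apply, twist3_apply, configPerm_apply]
  simp only [sitePerm_apply, Equiv.symm_symm, Equiv.apply_symm_apply, Function.comp_apply]

omit [NeZero L] in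
/-- `gaugeTransform g (P_π V) = P_π (gaugeTransform (g ∘ sitePerm π) V)`. [folklore] -/
theorem gaugeTransform_configPerm (π : Equiv.Perm (Fin 3)) (g : Site 3 L → SU2) (V : GaugeConfig 3 L SU2) :
    gaugeTransform g (configPerm π V) = configPerm π (gaugeTransform (g ∘ sitePerm π) V) := by
  rw [configPerm_gaugeTransform]
  congr 1
  funext x
  simp only [Function.comp_apply]
  congr 1
  funext j
  simp only [sitePerm_apply, Equiv.symm_symm, Equiv.apply_symm_apply]

/-- Re-labelling the seam gauge field by a site permutation preserves its Haar measure. [folklore] -/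
theorem measurePreserving_gauge_arrowCongr (σ : Site 3 L ≃ Site 3 L) :
    MeasurePreserving (MeasurableEquiv.arrowCongr' σ (MeasurableEquiv.refl SU2)) (gaugeMeasure L) (gaugeMeasure L) := by
  unfold gaugeMeasure
  exact measurePreserving_arrowCongr' (fun _ : Site 3 L => haarProbability SU2) (fun _ : Site 3 L => haarProbability SU2) σ
    (MeasurableEquiv.refl SU2) fun _ => MeasurePreserving.id _

omit [NeZero L] in
/-- The re-labelling map evaluated: `arrowCongr' σ 1 g = g ∘ σ⁻¹`. [folklore] -/
theorem gauge_arrowCongr_apply (σ : Site 3 L ≃ Site 3 L) (g : Site 3 L → SU2) :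
    (MeasurableEquiv.arrowCongr' σ (MeasurableEquiv.refl SU2)) g = g ∘ σ.symm := rfl

/-! ## §2 ★ The total sector weight is invariant -/

/-- ★ **Cubic symmetry of sector weights**: `W_{z ∘ π⁻¹}(1) = W_z(1)` for every axis permutation `π`. [cite: Luscher1983, §2] [cite: tHooft1979] -/
theorem sectorWeight_one_perm (β : ℝ) (n : ℕ) (z : Fin 3 → Bool) (π : Equiv.Perm (Fin 3)) :
    sectorWeight (L := L) β n (z ∘ π.symm) (fun _ _ => (1 : ℝ)) = sectorWeight (L := L) β n z (fun _ _ => (1 : ℝ)) := by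
  haveI := isProbabilityMeasure_gaugeMeasure (L := L)
  have h1 : Measurable (uncurry fun (_ : Fin (n + 1) → GaugeConfig 3 L SU2) (_ : Site 3 L → SU2) => (1 : ℝ)) := measurable_const
  have hb : ∀ (Us : Fin (n + 1) → GaugeConfig 3 L SU2) (g : Site 3 L → SU2),
      |(fun (_ : Fin (n + 1) → GaugeConfig 3 L SU2) (_ : Site 3 L → SU2) => (1 : ℝ)) Us g| ≤ 1 := fun _ _ => by simp
  rw [sectorWeight_eq_integral_prod β n _ h1 hb, sectorWeight_eq_integral_prod β n _ h1 hb]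
  set μ := (Measure.pi fun _ : Fin (n + 1) => configMeasure SU2 L).prod (gaugeMeasure L) with hμ
  -- the symmetry map of the ring space
  set σ : Site 3 L ≃ Site 3 L := sitePerm (L := L) π with hσ
  set Ψ : (Fin (n + 1) → GaugeConfig 3 L SU2) × (Site 3 L → SU2) → (Fin (n + 1) → GaugeConfig 3 L SU2) × (Site 3 L → SU2) :=
    Prod.map (fun Us i => configPerm π (Us i)) (MeasurableEquiv.arrowCongr' σ (MeasurableEquiv.refl SU2)) with hΨ
  have hΨm : MeasurePreserving Ψ μ μ :=
    (measurePreserving_pi (fun _ : Fin (n + 1) => configMeasure SU2 L) (fun _ : Fin (n + 1) => configMeasure SU2 L)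
      (fun _ => measurePreserving_configPerm' (L := L) π)).prod (measurePreserving_gauge_arrowCongr (L := L) σ)
  -- the `z`-chain is the `z ∘ π⁻¹`-chain after the symmetry
  set w : (Fin 3 → Bool) → (Fin (n + 1) → GaugeConfig 3 L SU2) × (Site 3 L → SU2) → ℝ := fun z' p =>
    (∏ i : Fin n, transferKernel su2Rep β (p.1 i.castSucc) (p.1 i.succ)) *
      transferKernel su2Rep β (p.1 (Fin.last n)) (gaugeTransform p.2 (twist3 z' (p.1 0))) * (1 : ℝ) with hw
  have hwm : ∀ z', Measurable (w z') := fun z' =>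
    measurable_sectorIntegrand (L := L) β n z' (F := fun _ _ => (1 : ℝ)) measurable_const
  have hinv : ∀ p, w (z ∘ π.symm) (Ψ p) = w z p := by
    intro p
    simp only [hw, hΨ, Prod.map_fst, Prod.map_snd, transferKernel_su2Rep_configPerm, gauge_arrowCongr_apply, hσ]
    rw [← configPerm_twist3, gaugeTransform_configPerm, transferKernel_su2Rep_configPerm]
    have hg : (p.2 ∘ ⇑(sitePerm (L := L) π).symm) ∘ ⇑(sitePerm (L := L) π) = p.2 := by
      funext x; simp only [Function.comp_apply, Equiv.symm_apply_apply]
    rw [hg]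
  -- change of variables
  have hcov : ∫ p, w (z ∘ π.symm) (Ψ p) ∂μ = ∫ p, w (z ∘ π.symm) p ∂μ := by
    have hsm : AEStronglyMeasurable (w (z ∘ π.symm)) (Measure.map Ψ μ) := by
      rw [hΨm.map_eq]; exact (hwm _).aestronglyMeasurable
    have h := integral_map hΨm.measurable.aemeasurable hsm
    rw [hΨm.map_eq] at h
    exact h.symm
  show ∫ p, w (z ∘ π.symm) p ∂μ = ∫ p, w z p ∂μ
  rw [← hcov]
  exact integral_congr_ae (Filter.Eventually.of_forall hinv)

/-! ## §3 The singly- and doubly-twisted sectors -/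

/-- The twist vector with a single `true` at `k`. [folklore] -/
theorem single_comp_swap (k l : Fin 3) :
    (fun j : Fin 3 => decide (j = k)) ∘ (Equiv.swap k l).symm = fun j : Fin 3 => decide (j = l) := by
  funext j
  simp only [Function.comp_apply, Equiv.symm_swap]
  by_cases hj : j = l
  · subst hj; simp [Equiv.swap_apply_right]
  · by_cases hjk : j = k
    · subst hjk
      simp [Equiv.swap_apply_left, Ne.symm hj, hj]
    · simp [Equiv.swap_apply_of_ne_of_ne hjk hj, hjk, hj]

/-- ★ Singly-twisted sectors have equal total weights: `W_{e_k}(1) = W_{e_l}(1)`. [cite: Luscher1983, §2] -/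
theorem sectorWeight_one_eq_of_single (β : ℝ) (n : ℕ) (k l : Fin 3) :
    sectorWeight (L := L) β n (fun j : Fin 3 => decide (j = k)) (fun _ _ => (1 : ℝ)) =
      sectorWeight (L := L) β n (fun j : Fin 3 => decide (j = l)) (fun _ _ => (1 : ℝ)) := by
  rw [← sectorWeight_one_perm β n (fun j : Fin 3 => decide (j = k)) (Equiv.swap k l), single_comp_swap]

/-- The twist vector with a single `false` at `k`. [folklore] -/
theorem cosingle_comp_swap (k l : Fin 3) :
    (fun j : Fin 3 => !decide (j = k)) ∘ (Equiv.swap k l).symm = fun j : Fin 3 => !decide (j = l) := by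
  have h := single_comp_swap k l
  funext j
  have hj := congrFun h j
  simp only [Function.comp_apply] at hj ⊢
  rw [hj]

/-- ★ Doubly-twisted sectors have equal total weights: `W_{1 − e_k}(1) = W_{1 − e_l}(1)`. [cite: Luscher1983, §2] -/
theorem sectorWeight_one_eq_of_double (β : ℝ) (n : ℕ) (k l : Fin 3) :
    sectorWeight (L := L) β n (fun j : Fin 3 => !decide (j = k)) (fun _ _ => (1 : ℝ)) =
      sectorWeight (L := L) β n (fun j : Fin 3 => !decide (j = l)) (fun _ _ => (1 : ℝ)) := by
  rw [← sectorWeight_one_perm β n (fun j : Fin 3 => !decide (j = k)) (Equiv.swap k l), cosingle_comp_swap]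

end Summit.QuantumFields.YangMills.Theorems.FemtoTransferGap.TT

end
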